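import Literature.Probability.RandomPlanarGeometry.ChordalCurveFamilyProofs
import HarnessLib

/-!
# Common prefixes force equal stopped curves: partial helper for stub `stub_freeAxioms` of line
`crosscut-dictionary` for crux `LagHandOff` (stmt-CriticalPhenomena-10268)

Deterministic curve-space input of the LOCALITY conjuncts (`ChordalFamily.IsLocal`,
`ChordalFamily.IsTargetIndependent`) of the registered stub `stub_freeAxioms` (namespace
`Summit.CriticalPhenomena.CardyFormulaZ2.Cruxes.LagHandOff.CrosscutDictionary`).  On the
lattice, the explorations of two Dobrushin data that agree away from a closed set `F` share a
common prefix ending within `O(δ)` of `F`; in the joint scaling limit this becomes: curve classes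
`Y`, `Z` are limits of classes `[cₖ]`, `[c'ₖ]` of parametrised curves agreeing on `[0, sₖ]` with
`cₖ sₖ` in the closed `ηₖ`-neighbourhood of `F`, `ηₖ → 0`.  `stopAt_eq_of_commonPrefix` proves
that then `CurveClass.stopAt F Y = CurveClass.stopAt F Z` — with NO probabilistic input and no
continuity of `stopAt` (which fails at curves touching `F` without entering it): choose sup-close
reparametrisations (`Curve.exists_dist_reparam_lt`), compare heads
(`Curve.dist_head_reparam_head_eq_zero`, `Curve.dist_comp_comp_le_dist`), extract a limit head
`p` along a subsequence of head parameters (`Curve.tendsto_dist_comp_affineClamp`), note that `p`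
is a head of both `Y` and `Z` ending in `F`, and use that the stopped curve of a curve is the
stopped curve of any of its heads ending in `F` (`stopAt_head_of_mem`, an identity of
parametrised curves) together with representative independence of stopping
(`CurveClass.stopAt_mk_holds`, in tree).  The registered sub-stub
`stub_freeAxioms_commonPrefix` is the planar instance.

References: G. Lawler, O. Schramm, W. Werner, Acta Math. 187 (2001) §2 (locality: the curves
agree up to the exit time); M. Aizenman, A. Burchard, Duke Math. J. 99 (1999) §2.1 (curve space).
-/

noncomputable section

open MeasureTheory Filter Set Topology
open scoped unitInterval ENNReal
open Literature.Probability.RandomPlanarGeometry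

namespace Summit.CriticalPhenomena.CardyFormulaZ2.Cruxes.LagHandOff.CrosscutDictionary

section Head

variable {E : Type*} [TopologicalSpace E]

/-- Pointwise formula for the head `γ ∘ affineClamp 0 u` of a curve up to parameter `u`. -/
theorem head_apply (γ : Curve E) (u t : I) :
    (⟨γ.toContinuousMap.comp (Curve.affineClamp 0 u)⟩ : Curve E) t =
      γ (Set.projIcc 0 1 zero_le_one ((u : ℝ) * t)) := by
  show (γ.toContinuousMap.comp (Curve.affineClamp 0 u)) t = _
  rw [ContinuousMap.comp_apply, Curve.affineClamp_apply, zero_add, Curve.coe_toContinuousMap]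

/-- The head up to `u` ends at `γ u`. -/
theorem head_target (γ : Curve E) (u : I) :
    (⟨γ.toContinuousMap.comp (Curve.affineClamp 0 u)⟩ : Curve E).target = γ u := by
  rw [Curve.target_def, head_apply]
  simp only [Set.Icc.coe_one, mul_one, Set.projIcc_val]

/-- The parameters of the head up to `u` stay below `u`. -/
theorem affineClamp_zero_le (u t : I) : Curve.affineClamp 0 u t ≤ u := by
  rw [Curve.affineClamp_apply, zero_add]
  have hmem : (u : ℝ) * t ∈ Icc (0 : ℝ) 1 := unitInterval.mul_mem u.2 t.2
  rw [Set.projIcc_of_mem _ hmem]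
  exact Subtype.coe_le_coe.1 (mul_le_of_le_one_right (unitInterval.nonneg u)
    (unitInterval.le_one t))

/-- **Stopping a head.** If `γ u ∈ F` (closed `F`), the head of `γ` up to `u` and `γ` itself
have the same initial segment up to the first hitting of `F` (as parametrised curves). -/
theorem stopAt_head_of_mem {F : Set E} (hF : IsClosed F) (γ : Curve E) (u : I) (hu : γ u ∈ F) :
    (⟨γ.toContinuousMap.comp (Curve.affineClamp 0 u)⟩ : Curve E).stopAt F = γ.stopAt F := by
  set η : Curve E := ⟨γ.toContinuousMap.comp (Curve.affineClamp 0 u)⟩ with hη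
  have happly : ∀ t : I, η t = γ (projIcc 0 1 zero_le_one ((u : ℝ) * t)) := head_apply γ u
  have hT : γ.hitParam F ≤ u := Curve.hitParam_le hu
  have hT0 : 0 ≤ γ.hitParam F := (γ.hitParam_mem_Icc F).1
  have hTu : η.hitParam F ∈ Icc (0 : ℝ) 1 := η.hitParam_mem_Icc F
  -- key identity: `u * T_η = T_γ`
  have hkey : (u : ℝ) * η.hitParam F = γ.hitParam F := by
    apply le_antisymm
    · rcases eq_or_lt_of_le (unitInterval.nonneg u) with h0 | hpos
      · rw [← h0, zero_mul]
        exact hT0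
      · have hmemI : γ.hitParam F / u ∈ Icc (0 : ℝ) 1 :=
          ⟨div_nonneg hT0 hpos.le, div_le_one_of_le₀ hT hpos.le⟩
        have hγT : γ ⟨γ.hitParam F, γ.hitParam_mem_Icc F⟩ ∈ F :=
          Curve.apply_hitParam_mem hF ⟨u, hu⟩
        have hηt : η ⟨γ.hitParam F / u, hmemI⟩ ∈ F := by
          rw [happly]
          have hmul : (u : ℝ) * (γ.hitParam F / u) = γ.hitParam F :=
            mul_div_cancel₀ (γ.hitParam F) hpos.ne'
          simp only [hmul]
          rw [Set.projIcc_of_mem _ (γ.hitParam_mem_Icc F)]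
          exact hγT
        have hle := Curve.hitParam_le hηt
        calc (u : ℝ) * η.hitParam F ≤ u * (γ.hitParam F / u) :=
              mul_le_mul_of_nonneg_left hle (unitInterval.nonneg u)
          _ = γ.hitParam F := mul_div_cancel₀ (γ.hitParam F) hpos.ne'
    · rcases Curve.hitParam_mem_hitSet hF η with ⟨hI, hmem⟩ | h1
      · rw [happly] at hmem
        have hle := Curve.hitParam_le hmem
        rwa [Set.projIcc_of_mem _ (unitInterval.mul_mem u.2 hTu)] at hle
      · rw [mem_singleton_iff] at h1
        rw [h1, mul_one]
        exact hT
  refine Curve.ext (ContinuousMap.ext fun t => ?_)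
  show η.stopAt F t = γ.stopAt F t
  rw [Curve.stopAt_apply, Curve.stopAt_apply, happly]
  congr 1
  rw [Set.projIcc_of_mem _ (unitInterval.mul_mem hTu t.2), ← mul_assoc, hkey]

end Head

section Metric

variable {E : Type*} [MetricSpace E]

/-- **Common prefixes force equal stopped curves.** Let `F` be closed and `[cₖ] → Y`,
`[c'ₖ] → Z` in the space of curve classes, where for every `k` the parametrised curves `cₖ`
and `c'ₖ` agree on `[0, sₖ]` and `cₖ sₖ` lies in the closed `ηₖ`-neighbourhood of `F`,
`ηₖ → 0`.  Then `Y` and `Z` have the same initial segment up to the first hitting of `F`: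
`stopAt F Y = stopAt F Z`.  (Heads of sup-close reparametrised curves are close; extract a limit
head `p` of the common heads, a prefix of both `Y` and `Z` ending in `F`; the stopped curve of a
curve is the stopped curve of any of its heads ending in `F`, `stopAt_head_of_mem`, and stopping
is representative independent, `CurveClass.stopAt_mk_holds`.) -/
theorem stopAt_eq_of_commonPrefix {F : Set E} (hF : IsClosed F) {Y Z : CurveClass E}
    (c c' : ℕ → Curve E) (s : ℕ → I) (η : ℕ → ℝ)
    (hY : Tendsto (fun k => CurveClass.mk (c k)) atTop (𝓝 Y))
    (hZ : Tendsto (fun k => CurveClass.mk (c' k)) atTop (𝓝 Z))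
    (hagree : ∀ k (t : I), t ≤ s k → c k t = c' k t)
    (hend : ∀ k, c k (s k) ∈ Metric.cthickening (η k) F)
    (hη : Tendsto η atTop (𝓝 0)) :
    CurveClass.stopAt F Y = CurveClass.stopAt F Z := by
  obtain ⟨y, rfl⟩ := CurveClass.surjective_mk Y
  obtain ⟨z, rfl⟩ := CurveClass.surjective_mk Z
  -- distances to the limit representatives
  have hdY : Tendsto (fun k => dist (c k) y) atTop (𝓝 0) := by
    have h := (tendsto_iff_dist_tendsto_zero.1 hY)
    simpa only [CurveClass.dist_mk_mk] using h
  have hdZ : Tendsto (fun k => dist (c' k) z) atTop (𝓝 0) := by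
    have h := (tendsto_iff_dist_tendsto_zero.1 hZ)
    simpa only [CurveClass.dist_mk_mk] using h
  have hεY : ∀ k : ℕ, dist (c k) y < dist (c k) y + 1 / ((k : ℝ) + 1) := fun k => by
    have : (0 : ℝ) < 1 / ((k : ℝ) + 1) := by positivity
    linarith
  have hεZ : ∀ k : ℕ, dist (c' k) z < dist (c' k) z + 1 / ((k : ℝ) + 1) := fun k => by
    have : (0 : ℝ) < 1 / ((k : ℝ) + 1) := by positivity
    linarith
  choose φ hφ using fun k => Curve.exists_dist_reparam_lt (hεY k)
  choose ψ hψ using fun k => Curve.exists_dist_reparam_lt (hεZ k)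
  -- the heads: common head `H k`, heads of `y`, `z` up to `u k := φ k (s k)`, `v k := ψ k (s k)`
  set u : ℕ → I := fun k => φ k (s k) with hu
  set v : ℕ → I := fun k => ψ k (s k) with hv
  have hHY : ∀ k, dist (⟨(c k).toContinuousMap.comp (Curve.affineClamp 0 (s k))⟩ : Curve E)
      ⟨y.toContinuousMap.comp (Curve.affineClamp 0 (u k))⟩ ≤ dist (c k) y + 1 / ((k : ℝ) + 1) := by
    intro k
    calc _ ≤ dist (⟨(c k).toContinuousMap.comp (Curve.affineClamp 0 (s k))⟩ : Curve E)
            ⟨(y.reparam (φ k)).toContinuousMap.comp (Curve.affineClamp 0 (s k))⟩ +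
          dist (⟨(y.reparam (φ k)).toContinuousMap.comp (Curve.affineClamp 0 (s k))⟩ : Curve E)
            ⟨y.toContinuousMap.comp (Curve.affineClamp 0 (u k))⟩ := dist_triangle _ _ _
      _ ≤ dist (c k).toContinuousMap (y.reparam (φ k)).toContinuousMap + 0 :=
          add_le_add (Curve.dist_comp_comp_le_dist _ _ _)
            (Curve.dist_head_reparam_head_eq_zero y (φ k) (s k) (u k) rfl).le
      _ ≤ _ := by rw [add_zero]; exact (hφ k).le
  have hHZ : ∀ k, dist (⟨(c' k).toContinuousMap.comp (Curve.affineClamp 0 (s k))⟩ : Curve E)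
      ⟨z.toContinuousMap.comp (Curve.affineClamp 0 (v k))⟩ ≤
        dist (c' k) z + 1 / ((k : ℝ) + 1) := by
    intro k
    calc _ ≤ dist (⟨(c' k).toContinuousMap.comp (Curve.affineClamp 0 (s k))⟩ : Curve E)
            ⟨(z.reparam (ψ k)).toContinuousMap.comp (Curve.affineClamp 0 (s k))⟩ +
          dist (⟨(z.reparam (ψ k)).toContinuousMap.comp (Curve.affineClamp 0 (s k))⟩ : Curve E)
            ⟨z.toContinuousMap.comp (Curve.affineClamp 0 (v k))⟩ := dist_triangle _ _ _
      _ ≤ dist (c' k).toContinuousMap (z.reparam (ψ k)).toContinuousMap + 0 :=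
          add_le_add (Curve.dist_comp_comp_le_dist _ _ _)
            (Curve.dist_head_reparam_head_eq_zero z (ψ k) (s k) (v k) rfl).le
      _ ≤ _ := by rw [add_zero]; exact (hψ k).le
  have hHeq : ∀ k, (⟨(c k).toContinuousMap.comp (Curve.affineClamp 0 (s k))⟩ : Curve E) =
      ⟨(c' k).toContinuousMap.comp (Curve.affineClamp 0 (s k))⟩ := by
    intro k
    refine Curve.ext (ContinuousMap.ext fun t => ?_)
    show (c k) (Curve.affineClamp 0 (s k) t) = (c' k) (Curve.affineClamp 0 (s k) t)
    exact hagree k _ (affineClamp_zero_le (s k) t)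
  -- a subsequence along which `(u k, v k) → (u⋆, v⋆)`
  obtain ⟨⟨uS, vS⟩, κ, hκ, hlim⟩ := CompactSpace.tendsto_subseq fun k => (u k, v k)
  have hulim : Tendsto (fun k => u (κ k)) atTop (𝓝 uS) :=
    (continuous_fst.tendsto (uS, vS)).comp hlim
  have hvlim : Tendsto (fun k => v (κ k)) atTop (𝓝 vS) :=
    (continuous_snd.tendsto (uS, vS)).comp hlim
  have hA : Tendsto (fun k => dist (⟨y.toContinuousMap.comp (Curve.affineClamp 0 uS)⟩ : Curve E)
      ⟨y.toContinuousMap.comp (Curve.affineClamp 0 (u (κ k)))⟩) atTop (𝓝 0) :=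
    Curve.tendsto_dist_comp_affineClamp y hulim (fun _ => (0 : ℝ)) (fun w => (w : ℝ))
      (fun _ _ => by rw [sub_self, abs_zero]; exact abs_nonneg _) (fun _ _ => le_rfl)
  have hB : Tendsto (fun k => dist (⟨z.toContinuousMap.comp (Curve.affineClamp 0 vS)⟩ : Curve E)
      ⟨z.toContinuousMap.comp (Curve.affineClamp 0 (v (κ k)))⟩) atTop (𝓝 0) :=
    Curve.tendsto_dist_comp_affineClamp z hvlim (fun _ => (0 : ℝ)) (fun w => (w : ℝ))
      (fun _ _ => by rw [sub_self, abs_zero]; exact abs_nonneg _) (fun _ _ => le_rfl)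
  have hrateY : Tendsto (fun k => dist (c (κ k)) y + 1 / (((κ k : ℕ) : ℝ) + 1)) atTop (𝓝 0) := by
    have h := (hdY.comp hκ.tendsto_atTop).add
      (tendsto_one_div_add_atTop_nhds_zero_nat.comp hκ.tendsto_atTop)
    simpa only [add_zero, Function.comp_def] using h
  have hrateZ : Tendsto (fun k => dist (c' (κ k)) z + 1 / (((κ k : ℕ) : ℝ) + 1)) atTop (𝓝 0) := by
    have h := (hdZ.comp hκ.tendsto_atTop).add
      (tendsto_one_div_add_atTop_nhds_zero_nat.comp hκ.tendsto_atTop)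
    simpa only [add_zero, Function.comp_def] using h
  -- the limit heads of `y` up to `u⋆` and of `z` up to `v⋆` are the same class
  have hkey : dist (⟨y.toContinuousMap.comp (Curve.affineClamp 0 uS)⟩ : Curve E)
      ⟨z.toContinuousMap.comp (Curve.affineClamp 0 vS)⟩ = 0 := by
    have hsum : Tendsto (fun k =>
        dist (⟨y.toContinuousMap.comp (Curve.affineClamp 0 uS)⟩ : Curve E)
            ⟨y.toContinuousMap.comp (Curve.affineClamp 0 (u (κ k)))⟩ +
          (dist (c (κ k)) y + 1 / (((κ k : ℕ) : ℝ) + 1)) +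
          (dist (c' (κ k)) z + 1 / (((κ k : ℕ) : ℝ) + 1)) +
          dist (⟨z.toContinuousMap.comp (Curve.affineClamp 0 vS)⟩ : Curve E)
            ⟨z.toContinuousMap.comp (Curve.affineClamp 0 (v (κ k)))⟩) atTop (𝓝 0) := by
      have h := ((hA.add hrateY).add hrateZ).add hB
      simpa only [add_zero] using h
    refine le_antisymm (ge_of_tendsto' hsum fun k => ?_) dist_nonneg
    have h1 := dist_triangle4 (⟨y.toContinuousMap.comp (Curve.affineClamp 0 uS)⟩ : Curve E)
      ⟨y.toContinuousMap.comp (Curve.affineClamp 0 (u (κ k)))⟩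
      ⟨(c' (κ k)).toContinuousMap.comp (Curve.affineClamp 0 (s (κ k)))⟩
      ⟨z.toContinuousMap.comp (Curve.affineClamp 0 vS)⟩
    have h2 := dist_triangle (⟨(c' (κ k)).toContinuousMap.comp (Curve.affineClamp 0 (s (κ k)))⟩ : Curve E)
      ⟨z.toContinuousMap.comp (Curve.affineClamp 0 (v (κ k)))⟩
      ⟨z.toContinuousMap.comp (Curve.affineClamp 0 vS)⟩
    have h3 := hHY (κ k)
    rw [hHeq (κ k), dist_comm] at h3
    have h4 := hHZ (κ k)
    have h5 := dist_comm (⟨z.toContinuousMap.comp (Curve.affineClamp 0 (v (κ k)))⟩ : Curve E)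
      ⟨z.toContinuousMap.comp (Curve.affineClamp 0 vS)⟩
    linarith
  -- the common endpoint `y u⋆ = z v⋆` lies in `F`
  have hyu : y uS ∈ F := by
    have hcont : Tendsto (fun k => Metric.infEDist (y (u (κ k))) F) atTop
        (𝓝 (Metric.infEDist (y uS) F)) :=
      (Metric.continuous_infEDist.tendsto _).comp ((y.continuous.tendsto uS).comp hulim)
    have hbound : ∀ k, Metric.infEDist (y (u k)) F ≤
        ENNReal.ofReal (η k) + ENNReal.ofReal (dist (c k) y + 1 / ((k : ℝ) + 1)) := by
      intro k
      have h1 : Metric.infEDist (c k (s k)) F ≤ ENNReal.ofReal (η k) :=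
        Metric.mem_cthickening_iff.1 (hend k)
      have h2 : edist (y (u k)) (c k (s k)) ≤
          ENNReal.ofReal (dist (c k) y + 1 / ((k : ℝ) + 1)) := by
        rw [edist_comm, edist_dist]
        refine ENNReal.ofReal_le_ofReal ?_
        have hpt := ContinuousMap.dist_apply_le_dist (f := (c k).toContinuousMap)
          (g := (y.reparam (φ k)).toContinuousMap) (s k)
        rw [Curve.coe_toContinuousMap, Curve.coe_toContinuousMap, Curve.reparam_apply] at hpt
        exact hpt.trans (hφ k).le
      exact Metric.infEDist_le_infEDist_add_edist.trans (add_le_add h1 h2)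
    have hzero : Tendsto (fun k => ENNReal.ofReal (η (κ k)) +
        ENNReal.ofReal (dist (c (κ k)) y + 1 / (((κ k : ℕ) : ℝ) + 1))) atTop (𝓝 0) := by
      have h := (ENNReal.tendsto_ofReal (hη.comp hκ.tendsto_atTop)).add
        (ENNReal.tendsto_ofReal hrateY)
      simpa only [ENNReal.ofReal_zero, add_zero, Function.comp_def] using h
    have hle : Metric.infEDist (y uS) F ≤ 0 :=
      le_of_tendsto_of_tendsto hcont hzero (Eventually.of_forall fun k => hbound (κ k))
    rw [← hF.closure_eq, Metric.mem_closure_iff_infEDist_zero]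
    exact nonpos_iff_eq_zero.1 hle
  have hzv : z vS ∈ F := by
    rw [← head_target z vS, ← Curve.target_eq_of_dist_eq_zero hkey, head_target]
    exact hyu
  -- assemble
  calc CurveClass.stopAt F (CurveClass.mk y)
      = CurveClass.mk (y.stopAt F) := CurveClass.stopAt_mk_holds F hF y
    _ = CurveClass.mk ((⟨y.toContinuousMap.comp (Curve.affineClamp 0 uS)⟩ : Curve E).stopAt F) := by
        rw [stopAt_head_of_mem hF y uS hyu]
    _ = CurveClass.stopAt F
          (CurveClass.mk (⟨y.toContinuousMap.comp (Curve.affineClamp 0 uS)⟩ : Curve E)) :=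
        (CurveClass.stopAt_mk_holds F hF _).symm
    _ = CurveClass.stopAt F
          (CurveClass.mk (⟨z.toContinuousMap.comp (Curve.affineClamp 0 vS)⟩ : Curve E)) := by
        rw [CurveClass.mk_eq_mk_iff_dist_eq_zero.2 hkey]
    _ = CurveClass.mk ((⟨z.toContinuousMap.comp (Curve.affineClamp 0 vS)⟩ : Curve E).stopAt F) :=
        CurveClass.stopAt_mk_holds F hF _
    _ = CurveClass.mk (z.stopAt F) := by rw [stopAt_head_of_mem hF z vS hzv]
    _ = CurveClass.stopAt F (CurveClass.mk z) := (CurveClass.stopAt_mk_holds F hF z).symm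

end Metric

/-- **Registered sub-stub `stub_freeAxioms_commonPrefix`** (planar instance of
`stopAt_eq_of_commonPrefix`): limits of pairs of curve classes with common prefixes ending ever
closer to a closed set `F ⊆ ℂ` have equal initial segments up to the first hitting of `F`. -/
theorem stub_freeAxioms_commonPrefix : ∀ (F : Set ℂ), IsClosed F → ∀ (Y Z : CurveClass ℂ) (c c' : ℕ → Curve ℂ) (s : ℕ → unitInterval) (η : ℕ → ℝ), Tendsto (fun k => CurveClass.mk (c k)) atTop (𝓝 Y) → Tendsto (fun k => CurveClass.mk (c' k)) atTop (𝓝 Z) → (∀ (k : ℕ) (t : unitInterval), t ≤ s k → c k t = c' k t) → (∀ k, c k (s k) ∈ Metric.cthickening (η k) F) → Tendsto η atTop (𝓝 0) → CurveClass.stopAt F Y = CurveClass.stopAt F Z :=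
  fun _ hF _ _ c c' s η hY hZ hagree hend hη =>
    stopAt_eq_of_commonPrefix hF c c' s η hY hZ hagree hend hη

end Summit.CriticalPhenomena.CardyFormulaZ2.Cruxes.LagHandOff.CrosscutDictionary

end
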